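import Literature.Probability.LatticeModels.ObservableContinuumBounds
import HarnessLib

/-!
# From lattice bulk bounds to equicontinuity at scale `√δ`, for an abstract family

Topic `Literature/Probability/LatticeModels`; the observable-independent form of
`IsDiscretisation.exists_equicont_bound` (`ObservableContinuumBounds.lean`, Smirnov 2010 §5), for
the spin fermion of Chelkak–Hongler–Izyurov 2015 (Thm 3.12, equicontinuity (3.13)) whose lattice
Lipschitz bound is `KCObservableBulkBounds.norm_sub_kcObs_le_of_bulk` /
`KCObservableGaugedBounds.norm_sub_seamGaugeS_le_of_gaugedBulk`, and whose sup bound enters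
through `LatticeToContinuumSup.lean`.

* `LatticeLipHyp F K ρ C'`: per-step bounds `C'/((2q)√(2q))` on the horizontal edges at the sites
  of every ball of lattice radius `q ≥ 8` about a site with mesh point in `K`, as long as the ball
  of radius `64 q + 3` has Euclidean size `≤ ρ`;
* **`exists_equicont_bound_of_hyps`**: with a `√δ` sup bound on `K`,
  `‖F_δ(x') - F_δ(x)‖ ≤ L √δ (dist + δ)` for mesh points in `K`, eventually (lattice path of
  `O(dist/δ)` steps within distance `ρ/1000`, the sup bound beyond).

Everything is proved; no named fact.

## References

* S. Smirnov, Ann. of Math. 172 (2010), §5 [Smirnov2010].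
* D. Chelkak, C. Hongler, K. Izyurov, Ann. of Math. 181 (2015), Thm 3.12 [ChelkakHonglerIzyurovAnnals2015].
-/

noncomputable section

namespace Literature.Probability.LatticeModels

open Filter _root_.Topology Metric Set Finset DiscreteDobrushin

/-- **The lattice Lipschitz hypothesis** for a family of bond functions on a set `K`. [cite: Smirnov2010, §5] -/
def LatticeLipHyp (F : ℝ → MedialVertex → ℂ) (K : Set ℂ) (ρ C' : ℝ) : Prop :=
  ∀ᶠ δ in 𝓝[>] (0 : ℝ), ∀ x : Site 2, meshPoint δ x ∈ K → ∀ q : ℕ, 8 ≤ q →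
    δ * (2 * (2 * (2 * (4 * (2 * (q : ℝ))))) + 3) ≤ ρ →
      ∀ y ∈ latticeBall x q, ∀ j : Fin 4,
        ‖F δ (cSrc (y + cornerUnit j, 0)) - F δ (cSrc (y, 0))‖ ≤ C' / ((2 * q : ℕ) * Real.sqrt (2 * q : ℕ))

/-- **Equicontinuity at scale `√δ` from the lattice hypotheses.** [cite: Smirnov2010, §5; ChelkakHonglerIzyurovAnnals2015, Thm 3.12 (3.13)] -/
theorem exists_equicont_bound_of_hyps {F : ℝ → MedialVertex → ℂ} {K : Set ℂ} {ρ C' M : ℝ} (hρ : 0 < ρ) (hC' : 0 ≤ C')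
    (hM0 : 0 ≤ M) (hL : LatticeLipHyp F K ρ C')
    (hM : ∀ᶠ δ in 𝓝[>] (0 : ℝ), ∀ x : Site 2, meshPoint δ x ∈ K → ∀ i : Fin 4, (i = 0 ∨ i = 1) →
      ‖F δ (cSrc (x, i))‖ ≤ M * Real.sqrt δ) :
    ∃ L : ℝ, 0 ≤ L ∧ ∀ᶠ δ in 𝓝[>] (0 : ℝ), ∀ x x' : Site 2, meshPoint δ x ∈ K → meshPoint δ x' ∈ K →
      ‖F δ (cSrc (x', 0)) - F δ (cSrc (x, 0))‖ ≤ L * Real.sqrt δ * (dist (meshPoint δ x') (meshPoint δ x) + δ) := by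
  set L₁ : ℝ := 2 * C' * (200 / ρ) * Real.sqrt (200 / ρ) with hL₁
  set L₂ : ℝ := 2 * M * (1000 / ρ) with hL₂
  have hL₁0 : 0 ≤ L₁ := by positivity
  have hL₂0 : 0 ≤ L₂ := by positivity
  refine ⟨max L₁ L₂, le_max_of_le_left hL₁0, ?_⟩
  have hc : (0 : ℝ) < ρ / 2000 := by positivity
  have h2 : ∀ᶠ δ in 𝓝[>] (0 : ℝ), δ < ρ / 2000 := nhdsWithin_le_nhds (Iio_mem_nhds hc)
  have h3 : ∀ᶠ δ in 𝓝[>] (0 : ℝ), 0 < δ := self_mem_nhdsWithin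
  filter_upwards [hL, hM, h2, h3] with δ HL hMδ hδs hδ0 x x' hx hx'
  have hsq0 : 0 < Real.sqrt δ := Real.sqrt_pos.2 hδ0
  set dd := dist (meshPoint δ x') (meshPoint δ x) with hdd
  have hdd0 : 0 ≤ dd := dist_nonneg
  by_cases hfar : ρ / 1000 < dd
  · -- distant points: both values are `O(√δ)`
    have b1 := hMδ x hx 0 (Or.inl rfl)
    have b2 := hMδ x' hx' 0 (Or.inl rfl)
    calc ‖F δ (cSrc (x', 0)) - F δ (cSrc (x, 0))‖
        ≤ ‖F δ (cSrc (x', 0))‖ + ‖F δ (cSrc (x, 0))‖ := norm_sub_le _ _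
      _ ≤ 2 * M * Real.sqrt δ := by linarith
      _ ≤ L₂ * Real.sqrt δ * dd := by
          rw [hL₂]
          have : 1 ≤ (1000 / ρ) * dd := by
            rw [div_mul_eq_mul_div, le_div_iff₀ hρ]; linarith
          calc 2 * M * Real.sqrt δ = 2 * M * Real.sqrt δ * 1 := (mul_one _).symm
            _ ≤ 2 * M * Real.sqrt δ * ((1000 / ρ) * dd) := by gcongr
            _ = 2 * M * (1000 / ρ) * Real.sqrt δ * dd := by ring
      _ ≤ max L₁ L₂ * Real.sqrt δ * (dd + δ) := by
          have : L₂ * Real.sqrt δ * dd ≤ max L₁ L₂ * Real.sqrt δ * dd := by gcongr; exact le_max_right _ _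
          refine this.trans ?_
          have hm0 : 0 ≤ max L₁ L₂ * Real.sqrt δ := by positivity
          nlinarith
  · -- nearby points: a lattice path of `O(dd/δ)` steps, each `O(δ^{3/2})`
    push Not at hfar
    -- the lattice scale `q ≈ ρ/(200 δ)`
    set q : ℕ := ⌊ρ / (200 * δ)⌋₊ with hqdef
    have hqr : (0 : ℝ) < ρ / (200 * δ) := by positivity
    have hqle : (q : ℝ) ≤ ρ / (200 * δ) := Nat.floor_le hqr.le
    have hqlt : ρ / (200 * δ) < q + 1 := Nat.lt_floor_add_one _
    have hbig : (10 : ℝ) ≤ ρ / (200 * δ) := by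
      rw [le_div_iff₀ (by positivity)]; linarith
    have hq8 : 8 ≤ q := by
      have : (8 : ℝ) ≤ q := by linarith
      exact_mod_cast this
    have hq0 : (0 : ℝ) < q := by exact_mod_cast (show 0 < q by omega)
    have hδq : δ * q ≤ ρ / 200 := by
      rw [le_div_iff₀ (by norm_num : (0:ℝ) < 200)]
      have := mul_le_mul_of_nonneg_left hqle (by positivity : (0 : ℝ) ≤ 200 * δ)
      rw [mul_div_cancel₀ _ (by positivity)] at this
      linarith
    have hsize : δ * (2 * (2 * (2 * (4 * (2 * (q : ℝ))))) + 3) ≤ ρ := by nlinarith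
    -- per-step bound on the sup-ball of radius `q` about `x`
    set Λ : ℝ := C' / ((2 * q : ℕ) * Real.sqrt (2 * q : ℕ)) with hΛ
    have hΛ0 : 0 ≤ Λ := by rw [hΛ]; positivity
    have hstep : ∀ y : Site 2, supNear x q y → ∀ j : Fin 4,
        ‖F δ (cSrc (y + cornerUnit j, 0)) - F δ (cSrc (y, 0))‖ ≤ Λ := by
      intro y hy j
      have hyb : y ∈ latticeBall x q := by
        rw [mem_latticeBall_iff_supNear]; exact hy
      exact HL x hx q hq8 hsize y hyb j
    -- the sup-distance `n` from `x` to `x'` is at most `dd/δ ≤ q`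
    set n : ℕ := (max |x' 0 - x 0| |x' 1 - x 1|).toNat with hndef
    have hn0 : (0 : ℤ) ≤ max |x' 0 - x 0| |x' 1 - x 1| := le_max_of_le_left (abs_nonneg _)
    have hnz : (n : ℤ) = max |x' 0 - x 0| |x' 1 - x 1| := Int.toNat_of_nonneg hn0
    have hxn : supNear x n x' := by
      intro i; rw [hnz]
      fin_cases i
      · exact le_max_left _ _
      · exact le_max_right _ _
    have hnδ : (n : ℝ) * δ ≤ dd := by
      have e0 := abs_sub_mul_le_dist_meshPoint δ x x' 0
      have e1 := abs_sub_mul_le_dist_meshPoint δ x x' 1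
      rw [abs_of_pos hδ0] at e0 e1
      have hcast : (n : ℝ) = ((max |x' 0 - x 0| |x' 1 - x 1| : ℤ) : ℝ) := by exact_mod_cast hnz
      rw [hcast]
      rcases le_total |x' 0 - x 0| |x' 1 - x 1| with hle | hle
      · rw [max_eq_right hle]; push_cast; rw [mul_comm]; exact e1
      · rw [max_eq_left hle]; push_cast; rw [mul_comm]; exact e0
    have hnq : supNear x q x' := by
      refine supNear_mono hxn ?_
      have : (n : ℝ) ≤ q := by
        have h1 : (n : ℝ) * δ ≤ ρ / 1000 := hnδ.trans hfar
        have h2 : ρ / 1000 ≤ δ * q := by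
          have : ρ / (200 * δ) - 1 ≤ q := by linarith
          have h3 : δ * (ρ / (200 * δ) - 1) ≤ δ * q := mul_le_mul_of_nonneg_left this hδ0.le
          have h4 : δ * (ρ / (200 * δ) - 1) = ρ / 200 - δ := by field_simp
          linarith
        nlinarith
      exact_mod_cast this
    -- telescoping
    have hpath := norm_sub_le_of_supNear (fun y => F δ (cSrc (y, 0))) hΛ0 hxn
      (fun y hy j => hstep y (supNear_mono hy (by
        have : (n : ℝ) ≤ q := by
          have h1 : (n : ℝ) * δ ≤ ρ / 1000 := hnδ.trans hfar
          have : ρ / (200 * δ) - 1 ≤ q := by linarith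
          have h3 : δ * (ρ / (200 * δ) - 1) ≤ δ * q := mul_le_mul_of_nonneg_left this hδ0.le
          have h4 : δ * (ρ / (200 * δ) - 1) = ρ / 200 - δ := by field_simp
          nlinarith
        exact_mod_cast this)) j)
    -- `Λ ≤ 8 K C (200/ρ)^{3/2} δ^{3/2}` and `2 n Λ ≤ L₁ √δ dd`
    have h2q : ρ / (200 * δ) ≤ (2 * q : ℕ) := by
      push_cast; linarith
    have hΛle : Λ ≤ C' * ((200 / ρ) * Real.sqrt (200 / ρ)) * (δ * Real.sqrt δ) := by
      rw [hΛ]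
      have hX : 0 < ρ / (200 * δ) := hqr
      have h2q0 : (0 : ℝ) < (2 * q : ℕ) := by push_cast; linarith
      -- `1/((2q)√(2q)) ≤ (200δ/ρ)^{3/2}`
      have hinv : 1 / (((2 * q : ℕ) : ℝ) * Real.sqrt (2 * q : ℕ)) ≤ (200 * δ / ρ) * Real.sqrt (200 * δ / ρ) := by
        rw [div_le_iff₀ (by positivity)]
        have hs : Real.sqrt (ρ / (200 * δ)) ≤ Real.sqrt (2 * q : ℕ) := Real.sqrt_le_sqrt h2q
        have e1 : (200 * δ / ρ) * (ρ / (200 * δ)) = 1 := by field_simp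
        have e2 : Real.sqrt (200 * δ / ρ) * Real.sqrt (ρ / (200 * δ)) = 1 := by
          rw [← Real.sqrt_mul (by positivity), e1, Real.sqrt_one]
        calc (1 : ℝ) = ((200 * δ / ρ) * (ρ / (200 * δ))) * (Real.sqrt (200 * δ / ρ) * Real.sqrt (ρ / (200 * δ))) := by
              rw [e1, e2, one_mul]
          _ ≤ ((200 * δ / ρ) * (2 * q : ℕ)) * (Real.sqrt (200 * δ / ρ) * Real.sqrt (2 * q : ℕ)) := by
              gcongr
          _ = (200 * δ / ρ) * Real.sqrt (200 * δ / ρ) * (((2 * q : ℕ) : ℝ) * Real.sqrt (2 * q : ℕ)) := by ring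
      have e3 : (200 * δ / ρ) * Real.sqrt (200 * δ / ρ) = ((200 / ρ) * Real.sqrt (200 / ρ)) * (δ * Real.sqrt δ) := by
        rw [show 200 * δ / ρ = (200 / ρ) * δ by ring, Real.sqrt_mul (by positivity)]; ring
      calc C' / (((2 * q : ℕ) : ℝ) * Real.sqrt (2 * q : ℕ))
          = C' * (1 / (((2 * q : ℕ) : ℝ) * Real.sqrt (2 * q : ℕ))) := by ring
        _ ≤ C' * ((200 * δ / ρ) * Real.sqrt (200 * δ / ρ)) := by gcongr
        _ = _ := by rw [e3]; ring
    calc ‖F δ (cSrc (x', 0)) - F δ (cSrc (x, 0))‖ ≤ 2 * n * Λ := hpath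
      _ ≤ 2 * n * (C' * ((200 / ρ) * Real.sqrt (200 / ρ)) * (δ * Real.sqrt δ)) := by gcongr
      _ = L₁ * Real.sqrt δ * (n * δ) := by rw [hL₁]; ring
      _ ≤ L₁ * Real.sqrt δ * dd := by gcongr
      _ ≤ max L₁ L₂ * Real.sqrt δ * (dd + δ) := by
          have : L₁ * Real.sqrt δ * dd ≤ max L₁ L₂ * Real.sqrt δ * dd := by gcongr; exact le_max_left _ _
          refine this.trans ?_
          have hm0 : 0 ≤ max L₁ L₂ * Real.sqrt δ := by positivity
          nlinarith


end Literature.Probability.LatticeModels
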